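import Mathlib.Tactic.Linarith
import Mathlib.Tactic.NormNum
import Mathlib.Tactic.Ring
import Mathlib.Tactic.IntervalCases
import Mathlib.Algebra.BigOperators.Group.Finset.Basic
import HarnessLib

/-!
# The (0,1) cell of the ι-window, XXIX-B: the product ground `B₁ × B₂`, XVI (ADDENDUM 1) — the orbit lemma for punctual fillers at an ordinary double
# point and the enumeration-free use count (report [XXIX] §13): arithmetic shadows

Family `hodge`, b2b cell `hweil` (helper of item stmt-HodgeConjecture-2524). Companion (`pg16a_*`) of `WeilTypeLadderH2ProductGroundSixteen.lean` (same
seat). Report `run/shared/lean/b2b/hodge-weil/b2b-hweil-pv1-g41/H2-ZERO-ONE-29.md` ([XXIX]) §13 (ADDENDUM 1). HONEST FRAMING: census results inside the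
ladder's H2 test ((0,1) cell) on the SPECIAL fourfold `X₀ = B₁ × B₂`; nothing here is a rung; no case of the Hodge conjecture is proved; no statement of
[Markman 2025] / [Perry 2026] / [EdGFS 2025] is used. Every theorem is a def-free arithmetic identity that the report cites at the step named in its
docstring; none claims geometry.
-/

-- mandated namespace `Summit.HodgeConjecture.HodgeConjecture.…` (Problem = Summit) trips `linter.dupNamespace`; the lakefile disables it
-- tree-wide (weak option), restated here so stand-alone elaboration is warning-free too.
set_option linter.dupNamespace false

namespace Summit.HodgeConjecture.HodgeConjecture.WeilTypeLadder

section ProductGroundSixteenAdd1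

/-- **LEMMA FILL′ ([XXIX] 13.1): the graded pieces of the cone and the powers of its maximal ideal.** The coordinate ring of the threefold ordinary double
point `ab = cd` is `⊕_k R_k` with `R_k ≅ Sym^k ℂ² ⊗ Sym^k ℂ²` (the Segre cone over `ℙ¹ × ℙ¹`), `dim R_k = (k+1)²`, an IRREDUCIBLE representation of the connected
group `GO(4)° = (GL₂ × GL₂)/ℂ*`; so the only invariant ideals of finite colength are the powers `𝔪^k`, of colength `Σ_{j<k}(j+1)² = 1, 5, 14, 30, 55` (`k = 1..5`),
and at an ι-fixed point their local index is `16·Σ_{j<k}(−1)^j(j+1)² = 16, −48, 96, −160, 240` — never `0`: `𝔪^k` is unbalanced for every `k ≥ 1`, so at a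
fixed ordinary double point no balanced punctual part is `GO(4)°`-invariant. [`decide`] -/
theorem pg16a_cone_powers :
    (∀ k : ℕ, k ≤ 6 → (Finset.range k).sum (fun j => (j + 1) ^ 2) = k * (k + 1) * (2 * k + 1) / 6) ∧
    ((Finset.range 1).sum (fun j => (j + 1) ^ 2) = 1 ∧ (Finset.range 2).sum (fun j => (j + 1) ^ 2) = 5 ∧
     (Finset.range 3).sum (fun j => (j + 1) ^ 2) = 14 ∧ (Finset.range 4).sum (fun j => (j + 1) ^ 2) = 30) ∧
    (∀ k : ℕ, 1 ≤ k → k ≤ 6 → (Finset.range k).sum (fun j => (16:ℤ) * (-1) ^ j * ((j:ℤ) + 1) ^ 2) ≠ 0) := by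
  refine ⟨fun k hk => ?_, by decide, fun k h1 h6 => ?_⟩
  · interval_cases k <;> decide
  · interval_cases k <;> decide

/-- **LEMMA FILL′ ([XXIX] 13.1 (ii)): the explicit punctual deformation of `𝔪^k` (`k ≥ 2`) at a non-fixed ordinary double point.** With the bigraded
monomial basis `x^α y^β` (`|α| = |β| = k`) of `R_k` (`a = x₀y₀`, `b = x₁y₁`, `c = x₀y₁`, `d = x₁y₀`), the ideal `J_t := R_{≥k+1} + ⟨R_k-monomials ≠ b^k⟩ +
ℂ·(b^k − t·a^{k−1})` has `R/J_t` spanned by `R_{≤k−1}` for every `t` (the products `a^{k−1}·{a,b,c,d}` have degree `k` and are `≠ b^k` because their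
`x₀`-exponent `k` or `k − 1` is positive for `k ≥ 2`), so the colength `Σ_{j<k}(j+1)²` is CONSTANT and `J_t ≠ 𝔪^k` for `t ≠ 0`: `[𝔪^k]` is not an isolated point
of the punctual Hilbert scheme. Arithmetic shadow: for `2 ≤ k`, `0 < k − 1` and `0 < k`; and `(k+1)² − 1 + 1 = (k+1)²` (the degree-`k` piece of `J_t` plus the
one inhomogeneous generator account for all of `R_k` modulo `R_{k−1}`). [`omega` / `ring`] -/
theorem pg16a_power_deformation :
    (∀ k : ℕ, 2 ≤ k → 0 < k - 1 ∧ 0 < k) ∧ (∀ k : ℤ, (k + 1) ^ 2 - 1 + 1 = (k + 1) ^ 2) := by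
  refine ⟨fun k hk => by omega, fun k => by ring⟩

/-- **LEMMA USE-N** / THEOREM N** ([XXIX] 13.2–13.3): the enumeration-free use count.** For every row on a node-axis support: τ-uses `τ ≤ 2` (only `τ₁, τ₂`
create points on the conductor); WITH a diagonal the couplings number `U_c ≤ 2 + 1 = 3` (D1/D2's two + one theta, `m ≤ 1`) and the node-uses `n ≤ 1` (the diagonal
itself; no `(α)`, no `Z_H`); WITHOUT a diagonal `U_c ≤ 2` (thetas carrying base pairs: `m ≤ 2` for `W₀, W₀′` and all `G`-classes; for `W_w, W_w′` with `m = 3` the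
odd fibre parity leaves at most `3 − 1 = 2` thetas) and `n ≤ 2` (one `(α)`, one `Z_H`); every filler either moves off the match point (local length `1`) or
carries `≥ 1` punctual parameter at it (FILL′), contributing `f − f = 0`. Hence `U_c + τ + n ≤ 6` in both cases and transport gives `e₁^ι ≥ 9 − 6 = 3 ≥ 2` —
for EVERY H2-sheaf, whatever the matching pattern (`k ≤ 17`). Also: `m = 3` with an odd number `f ≥ 1` of fibres among `t + f = 3` atoms forces `t ≤ 2`.
[`omega`] -/
theorem pg16a_use_count :
    (∀ Uc τ n f p : ℕ, τ ≤ 2 → ((Uc ≤ 3 ∧ n ≤ 1) ∨ (Uc ≤ 2 ∧ n ≤ 2)) → f ≤ p → 3 ≤ 9 + p - (Uc + τ + n + f)) ∧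
    (∀ Uc τ n : ℕ, τ ≤ 2 → ((Uc ≤ 3 ∧ n ≤ 1) ∨ (Uc ≤ 2 ∧ n ≤ 2)) → Uc + τ + n ≤ 6) ∧ ((9:ℤ) - 6 = 3 ∧ (2:ℤ) ≤ 3) ∧
    (∀ t f : ℕ, t + f = 3 → f % 2 = 1 → t ≤ 2) ∧ ((2:ℕ) + 1 = 3 ∧ (17:ℕ) < 20) := by
  refine ⟨fun Uc τ n f p hτ h hf => by omega, fun Uc τ n hτ h => by omega, by norm_num, fun t f h1 h2 => by omega, by norm_num⟩

/-- **[XXIX] 13.2 (the windows with `m = 3`).** `m = a₂ − v_w + c − n₀ = 3` and the window condition `c_E^{(c)} + n₀ ≥ 0` are jointly solvable only for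
`W_w` (`a₂ = 2, v_w = 1, c = 0, c_E = 2`: `n₀ = −2`, target `0`) and `W_w′` (`a₂ = 1, v_w = −1, c_E = 1`: `n₀ = −1`, target `0`) — in both the target `v′ + τ′`
is `0`, so no `(α)` occurs —; for the other ten classes the target is negative: `W₀` (`2, 0, 0; c_E = 0`): `n₀ = −1`, `−1`; `W₀′` (`1, 0, 0; 1`): `−2`, `−1`;
`W_w+G` (`1, 1, 1; 1`): `−2`, `−1`; `W₀+G` (`1, 0, 1; −1`): `−1`, `−2`; `W_w′+G` (`0, −1, 1; 0`): `−1`, `−1`; `W₀′+G` (`0, 0, 1; 0`): `−2`, `−2`; and the `−G` classes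
(`a₂ + 2`, `c = −1`, same `c_E`) give the same `n₀` and targets. [`norm_num`] -/
theorem pg16a_m3_windows :
    ((2:ℤ) - 1 + 0 - 3 = -2 ∧ (2:ℤ) + (-2) = 0) ∧ ((1:ℤ) - (-1) + 0 - 3 = -1 ∧ (1:ℤ) + (-1) = 0) ∧
    ((2:ℤ) - 0 + 0 - 3 = -1 ∧ (0:ℤ) + (-1) < 0) ∧ ((1:ℤ) - 0 + 0 - 3 = -2 ∧ (1:ℤ) + (-2) < 0) ∧
    ((1:ℤ) - 1 + 1 - 3 = -2 ∧ (1:ℤ) + (-2) < 0) ∧ ((1:ℤ) - 0 + 1 - 3 = -1 ∧ (-1:ℤ) + (-1) < 0) ∧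
    ((0:ℤ) - (-1) + 1 - 3 = -1 ∧ (0:ℤ) + (-1) < 0) ∧ ((0:ℤ) - 0 + 1 - 3 = -2 ∧ (0:ℤ) + (-2) < 0) ∧
    (∀ a₂ v c : ℤ, (a₂ + 2) - v + (c - 2) - 3 = a₂ - v + c - 3) := by
  refine ⟨by norm_num, by norm_num, by norm_num, by norm_num, by norm_num, by norm_num, by norm_num, by norm_num, fun a₂ v c => by ring⟩

end ProductGroundSixteenAdd1

end Summit.HodgeConjecture.HodgeConjecture.WeilTypeLadder
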